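import Summits.AtomisticToContinuum.Crystallization.Theorems.OverbindingBudgetAffineFarFieldCollarAtlas

/-!
# Overbinding budget, affine far field — «CollarStar»: the k-major star test (27VI-SOUND (a4))

Support file for `Summit.AtomisticToContinuum.Crystallization.Theses.OverbindingBudget.RobustDefectLimitWindows`
(sub-problem (2c), leaf SW♭(30), part 27V, interface row (R*), soundness side «27VI-SOUND», integer part, item (a4) of the
critic's owed list r1768 (C)). «CollarAtlas» (246) typed the star domination (A3) SITE-MAJOR,
`∀ u ∈ B, ∀ k ∈ I, D²·star(u,k) ≤ 12·(2cN + 4·wN u + ρN k)² → wN u ≤ WN k`; decided literally that is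
`|B|·|I| ≈ 2.8e8` star tests (census «27V-I RE-TIMED»: 60 kernel-hours — not acceptable). This file realises it k-MAJOR over the
FIXED CANDIDATE BOX of a listed pair — the closed neighbourhoods of its two ends, `barlowCand s k = barlowBall s k.1 ∪ barlowBall
s k.2` (13 + 13 explicit sites: the end and its twelve neighbours by the Literature offset tables `sixOffsets` / `threeOffsets`,
20 distinct sites for a bond) — and proves the EXCLUSION LEMMA that makes the restriction sound:

* ★★ `le_barlowStarForm_of_bond`: for a bond `F(k.1,k.2) = 12` and a site `u ∉ barlowCand s k`, `108 ≤ star(u,k)` (census's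
  `|2p − 2q − v|² ≥ 18`; the star test radius `r₀ + 2w + ν/2 < 3ν/2` is `star < 108`);
* ★★ `le_barlowStarForm_of_contact`: for a contact pair `F(k.1,k.2) = 24` and `u ∉ barlowCand s k`, `48 ≤ star(u,k)`;
* ★★ `hA3_of_cand`: (A0) every listed pair is a bond or a contact, (A2) `cN + 2·wN u < D` on `B` (i.e. `r₀ + 2w < ν`,
  `w < 0.146ν`; the book of record has `w ≤ 0.04ν`) and the k-major condition
  (A3k) `∀ k ∈ I, ∀ u ∈ barlowCand s k, u ∈ B → D²·star ≤ 12(…)² → wN u ≤ WN k` GIVE (A3) for every `u ∈ B`;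
  ★ `hWd_of_cand` = «CollarAtlas» `hWd_of_atlas` with (A3) so supplied. Cost of (A3k): `|I|·26` star tests.

The exclusion lemma is a statement about ALL Hägg sequences; it is proved by transporting the form to LOCAL WORDS (the form of two
sites within two layers of a base layer `l` depends on `s` only through `(s(l−2), s(l−1), s l, s(l+1))`, `barlowSiteForm_eq_locForm`)
and ONE kernel enumeration per half of the sixteen words over the complete relative boxes (`locKernel_bond_pos/neg`,
`locKernel_contact`; `decide +kernel`, ≈ 25 s each): a site with `F(u,k.1) < 60` lies in `barlowBox k.1 2 5 3` («CollarAtlas»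
`mem_barlowBox_of_form_le`), the partner in `barlowBox k.1 1 2 1` (bond) / `barlowNbrBox` (contact).
[this file]
-/

namespace Summit.AtomisticToContinuum.Crystallization.Theorems.OverbindingBudgetAffineFarFieldCollarStar

noncomputable section

open Set Metric
open Literature.MathematicalPhysics.StatisticalMechanics
open Literature.Geometry.DiscreteGeometry (layerSpacing layerSpacing_sq')
open Summit.AtomisticToContinuum.Crystallization.Theorems.OverbindingBudgetAffineFarFieldCollarSites
open Summit.AtomisticToContinuum.Crystallization.Theorems.OverbindingBudgetAffineFarFieldCollarWindow
open Summit.AtomisticToContinuum.Crystallization.Theorems.OverbindingBudgetAffineFarFieldCollarAtlas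

local notation "E3" => EuclideanSpace ℝ (Fin 3)
local notation "Idx" => ℤ × ℤ × ℤ

/-! ## §1 Local words: near a base layer the form depends on four letters -/

/-- The eight length-four `±1` words with first letter `σ`. -/
def haggWords (σ : ℤ) : Finset (ℤ × ℤ × ℤ × ℤ) :=
  ({σ} : Finset ℤ) ×ˢ (({1, -1} : Finset ℤ) ×ˢ (({1, -1} : Finset ℤ) ×ˢ ({1, -1} : Finset ℤ)))

/-- The local word of `s` at the base layer `l`: `(s(l−2), s(l−1), s l, s(l+1))`. -/
def barlowWordAt (s : ℤ → ℤ) (l : ℤ) : ℤ × ℤ × ℤ × ℤ := (s (l - 2), s (l - 1), s l, s (l + 1))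

/-- The local label `haggLabel s (l + K) − haggLabel s l` read off the word (`|K| ≤ 2`). -/
def barlowLocLabel (w : ℤ × ℤ × ℤ × ℤ) (K : ℤ) : ℤ :=
  if K = 0 then 0 else if K = 1 then w.2.2.1 else if K = 2 then w.2.2.1 + w.2.2.2
  else if K = -1 then -w.2.1 else -w.2.1 - w.1

/-- The local form of two RELATIVE sites (layer offsets `|a.1|, |b.1| ≤ 2` from the base layer). -/
def locForm (w : ℤ × ℤ × ℤ × ℤ) (a b : Idx) : ℤ :=
  3 * (2 * (a.2.1 - b.2.1) + (a.2.2 - b.2.2) + (barlowLocLabel w a.1 - barlowLocLabel w b.1)) ^ 2 +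
    (3 * (a.2.2 - b.2.2) + (barlowLocLabel w a.1 - barlowLocLabel w b.1)) ^ 2 + 8 * (a.1 - b.1) ^ 2

/-- Relative coordinates about a base site. -/
def barlowRelIdx (k₁ u : Idx) : Idx := (u.1 - k₁.1, u.2.1 - k₁.2.1, u.2.2 - k₁.2.2)

/-- The relative search box about the origin. It is `@[irreducible]` for the ELABORATOR only (the kernel's `decide` unfolds it as
usual): a closed box term such as `barlowLocBox 2 5 3` met in a unification problem is otherwise unfolded and evaluated by `whnf`
(385 sites — a deterministic time-out in every proof that merely mentions a membership in it). -/
@[irreducible] def barlowLocBox (Ll La Lb : ℕ) : Finset Idx := barlowBox ((0 : ℤ), (0 : ℤ), (0 : ℤ)) Ll La Lb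

variable {s : ℤ → ℤ} {ν : ℝ} {q : E3} {R : E3 ≃ₗᵢ[ℝ] E3}

/-- support: the word of a Hägg sequence is a `±1` word. [this file] -/
theorem barlowWordAt_mem (hs : IsHaggSeq s) (l : ℤ) : barlowWordAt s l ∈ haggWords (s (l - 2)) := by
  simp only [haggWords, barlowWordAt, Finset.mem_product, Finset.mem_insert, Finset.mem_singleton, true_and]
  exact ⟨hs _, hs _, hs _⟩

/-- support: the label offsets within two layers of the base layer are read off the word. [BarlowStacking `haggLabel_succ`] -/
theorem haggLabel_sub_eq_barlowLocLabel (s : ℤ → ℤ) (l K : ℤ) (hK : -2 ≤ K) (hK' : K ≤ 2) :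
    haggLabel s (l + K) - haggLabel s l = barlowLocLabel (barlowWordAt s l) K := by
  have h1 := haggLabel_succ (s := s) l
  have h2 := haggLabel_succ (s := s) (l + 1)
  have h3 := haggLabel_succ (s := s) (l - 1)
  have h4 := haggLabel_succ (s := s) (l - 2)
  rw [sub_add_cancel] at h3
  rw [show l - 2 + 1 = l - 1 by ring] at h4
  rw [show l + 1 + 1 = l + 2 by ring] at h2
  unfold barlowLocLabel barlowWordAt
  rcases (show K = -2 ∨ K = -1 ∨ K = 0 ∨ K = 1 ∨ K = 2 by omega) with rfl | rfl | rfl | rfl | rfl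
  · rw [show l + -2 = l - 2 by ring]; norm_num; linarith
  · rw [show l + -1 = l - 1 by ring]; norm_num; linarith
  · norm_num
  · norm_num; linarith
  · norm_num; linarith

/-- support ★ TRANSPORT: within two layers of the base site the form is the local form of the relative sites. [this file] -/
theorem barlowSiteForm_eq_locForm (s : ℤ → ℤ) (k₁ u u' : Idx) (hu : -2 ≤ u.1 - k₁.1 ∧ u.1 - k₁.1 ≤ 2)
    (hu' : -2 ≤ u'.1 - k₁.1 ∧ u'.1 - k₁.1 ≤ 2) :
    barlowSiteForm s u u' = locForm (barlowWordAt s k₁.1) (barlowRelIdx k₁ u) (barlowRelIdx k₁ u') := by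
  have e1 := haggLabel_sub_eq_barlowLocLabel s k₁.1 (u.1 - k₁.1) hu.1 hu.2
  have e2 := haggLabel_sub_eq_barlowLocLabel s k₁.1 (u'.1 - k₁.1) hu'.1 hu'.2
  rw [show k₁.1 + (u.1 - k₁.1) = u.1 by ring] at e1
  rw [show k₁.1 + (u'.1 - k₁.1) = u'.1 by ring] at e2
  have eΛ : haggLabel s u.1 - haggLabel s u'.1 =
      barlowLocLabel (barlowWordAt s k₁.1) (u.1 - k₁.1) - barlowLocLabel (barlowWordAt s k₁.1) (u'.1 - k₁.1) := by linarith
  unfold barlowSiteForm locForm barlowRelIdx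
  rw [eΛ]
  ring

/-- support: the base site has relative coordinates `0`. [this file] -/
theorem barlowRelIdx_self (k₁ : Idx) : barlowRelIdx k₁ k₁ = (0, 0, 0) := by simp [barlowRelIdx]

/-- support: box membership in relative coordinates. [«CollarAtlas» `mem_barlowRange_iff`] -/
theorem barlowRelIdx_mem_barlowLocBox {k₁ u : Idx} {Ll La Lb : ℕ} (h : u ∈ barlowBox k₁ Ll La Lb) :
    barlowRelIdx k₁ u ∈ barlowLocBox Ll La Lb := by
  simp only [barlowBox, barlowLocBox, Finset.mem_product, mem_barlowRange_iff, barlowRelIdx] at h ⊢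
  omega

/-- support: the layer offset of a box member. [«CollarAtlas» `mem_barlowRange_iff`] -/
theorem layer_sub_of_mem_barlowBox {k₁ u : Idx} {Ll La Lb : ℕ} (h : u ∈ barlowBox k₁ Ll La Lb) :
    -(Ll : ℤ) ≤ u.1 - k₁.1 ∧ u.1 - k₁.1 ≤ Ll := by
  simp only [barlowBox, Finset.mem_product, mem_barlowRange_iff] at h
  omega

/-! ## §2 The kernel enumerations (one per half of the sixteen words) -/

/-- ★ KERNEL (bond, words starting with `+1`): in the complete relative boxes, a site that is not within form `12` of either end
of a local bond has `F(u,0) + F(u,k) ≥ 60`. [this file, `decide +kernel`] -/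
theorem locKernel_bond_pos : ∀ w ∈ haggWords 1, ∀ k ∈ barlowLocBox 1 2 1, locForm w (0, 0, 0) k = 12 →
    ∀ u ∈ barlowLocBox 2 5 3, locForm w u (0, 0, 0) ≤ 12 ∨ locForm w u k ≤ 12 ∨
      60 ≤ locForm w u (0, 0, 0) + locForm w u k := by
  set_option maxRecDepth 200000 in decide +kernel

/-- ★ KERNEL (bond, words starting with `−1`). [this file, `decide +kernel`] -/
theorem locKernel_bond_neg : ∀ w ∈ haggWords (-1), ∀ k ∈ barlowLocBox 1 2 1, locForm w (0, 0, 0) k = 12 →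
    ∀ u ∈ barlowLocBox 2 5 3, locForm w u (0, 0, 0) ≤ 12 ∨ locForm w u k ≤ 12 ∨
      60 ≤ locForm w u (0, 0, 0) + locForm w u k := by
  set_option maxRecDepth 200000 in decide +kernel

/-- ★ KERNEL (contact pairs, all sixteen words): a site not within form `12` of either end of a local contact pair (`F = 24`)
has `F(u,0) + F(u,k) ≥ 36`. [this file, `decide +kernel`] -/
theorem locKernel_contact : ∀ σ ∈ ({1, -1} : Finset ℤ), ∀ w ∈ haggWords σ, ∀ k ∈ barlowLocBox 1 3 2,
    locForm w (0, 0, 0) k = 24 → ∀ u ∈ barlowLocBox 2 4 2, locForm w u (0, 0, 0) ≤ 12 ∨ locForm w u k ≤ 12 ∨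
      36 ≤ locForm w u (0, 0, 0) + locForm w u k := by
  set_option maxRecDepth 200000 in decide +kernel

/-! ## §3 The candidate box of a listed pair and the exclusion lemmas -/

/-- The CLOSED NEIGHBOURHOOD of a site: the site and its twelve neighbours, by the explicit offset tables (in-layer `sixOffsets`,
layer above `threeOffsets (−s l)`, layer below `threeOffsets (s (l−1))`, BarlowCoordination `dist_barlowPos_eq_iff`). -/
def barlowBall (s : ℤ → ℤ) (v : Idx) : Finset Idx :=
  insert v
    ((sixOffsets.image fun pq : ℤ × ℤ => (v.1, v.2.1 - pq.1, v.2.2 - pq.2)) ∪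
      ((threeOffsets (-s v.1)).image fun pq : ℤ × ℤ => (v.1 + 1, v.2.1 - pq.1, v.2.2 - pq.2)) ∪
      ((threeOffsets (s (v.1 - 1))).image fun pq : ℤ × ℤ => (v.1 - 1, v.2.1 - pq.1, v.2.2 - pq.2)))

/-- ★ The CANDIDATE BOX of a pair: the closed neighbourhoods of its two ends (26 sites with multiplicity, 20 distinct for a bond). -/
def barlowCand (s : ℤ → ℤ) (k : Idx × Idx) : Finset Idx := barlowBall s k.1 ∪ barlowBall s k.2

/-- support: the form is a sum of squares. [«CollarSites»] -/
theorem barlowSiteForm_nonneg (s : ℤ → ℤ) (u u' : Idx) : 0 ≤ barlowSiteForm s u u' := by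
  unfold barlowSiteForm; positivity

/-- support: distinct sites have form `≥ 12` (the integer side of BarlowCoordination `le_dist_barlowPos_of_ideal`). -/
theorem twelve_le_barlowSiteForm (hs : IsHaggSeq s) {u u' : Idx} (hne : u ≠ u') : 12 ≤ barlowSiteForm s u u' := by
  have hne' : (u.1, u.2.1, u.2.2) ≠ (u'.1, u'.2.1, u'.2.2) := by
    intro h
    apply hne
    simp only [Prod.mk.injEq] at h
    exact Prod.ext h.1 (Prod.ext h.2.1 h.2.2)
  have hd := le_dist_barlowPos_of_ideal hs two_pos layerSpacing_sq' hne'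
  have h12 := twelve_mul_dist_barlowPos_sq layerSpacing_sq' s u.1 u.2.1 u.2.2 u'.1 u'.2.1 u'.2.2
  have hF : (12 : ℝ) ≤ (barlowSiteForm s u u' : ℝ) := by
    unfold barlowSiteForm
    have h4 : (2 : ℝ) ^ 2 ≤ dist (barlowPos 2 layerSpacing s u.1 u.2.1 u.2.2) (barlowPos 2 layerSpacing s u'.1 u'.2.1 u'.2.2) ^ 2 :=
      pow_le_pow_left₀ zero_le_two hd 2
    push_cast at h12 ⊢
    nlinarith
  exact_mod_cast hF

/-- support ★ COMPLETENESS OF THE CLOSED NEIGHBOURHOOD: a site of form `≤ 12` about `v` is `v` or one of its twelve listed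
neighbours. [BarlowCoordination `dist_barlowPos_eq_iff`, `dist_barlowPos_eq_iff_form`] -/
theorem mem_barlowBall_of_form_le (hs : IsHaggSeq s) {v u : Idx} (h : barlowSiteForm s v u ≤ 12) : u ∈ barlowBall s v := by
  unfold barlowBall
  by_cases hvu : u = v
  · subst hvu; exact Finset.mem_insert_self _ _
  have h12 : barlowSiteForm s v u = 12 := le_antisymm h (twelve_le_barlowSiteForm hs (Ne.symm hvu))
  have hd : dist (barlowPos 2 layerSpacing s v.1 v.2.1 v.2.2) (barlowPos 2 layerSpacing s u.1 u.2.1 u.2.2) = 2 :=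
    (dist_barlowPos_eq_iff_form two_pos layerSpacing_sq' s v.1 v.2.1 v.2.2 u.1 u.2.1 u.2.2).2 (by unfold barlowSiteForm at h12; exact h12)
  rcases (dist_barlowPos_eq_iff hs two_pos layerSpacing_sq' v.1 v.2.1 v.2.2 u.1 u.2.1 u.2.2).1 hd with
    ⟨hl, hm⟩ | ⟨hl, hm⟩ | ⟨hl, hm⟩
  · refine Finset.mem_insert_of_mem (Finset.mem_union_left _ (Finset.mem_union_left _ ?_))
    exact Finset.mem_image.2 ⟨_, hm, Prod.ext hl.symm (Prod.ext (by simp) (by simp))⟩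
  · refine Finset.mem_insert_of_mem (Finset.mem_union_left _ (Finset.mem_union_right _ ?_))
    exact Finset.mem_image.2 ⟨_, hm, Prod.ext hl.symm (Prod.ext (by simp) (by simp))⟩
  · refine Finset.mem_insert_of_mem (Finset.mem_union_right _ ?_)
    exact Finset.mem_image.2 ⟨_, hm, Prod.ext hl.symm (Prod.ext (by simp) (by simp))⟩

/-- support: a site within form `12` of either end is a candidate. [this file] -/
theorem mem_barlowCand_of_form_le (hs : IsHaggSeq s) {u : Idx} {k : Idx × Idx}
    (h : barlowSiteForm s u k.1 ≤ 12 ∨ barlowSiteForm s u k.2 ≤ 12) : u ∈ barlowCand s k := by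
  unfold barlowCand
  rcases h with h | h
  · exact Finset.mem_union_left _ (mem_barlowBall_of_form_le hs (by rwa [barlowSiteForm_comm]))
  · exact Finset.mem_union_right _ (mem_barlowBall_of_form_le hs (by rwa [barlowSiteForm_comm]))

/-- support: the three forms of the exclusion lemma in local coordinates (box sizes explicit: unification against concrete
boxes must never meet metavariables — the elaborator would otherwise unfold the boxes). [this file] -/
theorem forms_eq_locForm (s : ℤ → ℤ) (u : Idx) (k : Idx × Idx) (Ll La Lb Ll' La' Lb' : ℕ) (hL : Ll ≤ 2) (hL' : Ll' ≤ 2)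
    (hub : u ∈ barlowBox k.1 Ll La Lb) (hkb : k.2 ∈ barlowBox k.1 Ll' La' Lb') :
    barlowSiteForm s k.1 k.2 = locForm (barlowWordAt s k.1.1) (0, 0, 0) (barlowRelIdx k.1 k.2) ∧
      barlowSiteForm s u k.1 = locForm (barlowWordAt s k.1.1) (barlowRelIdx k.1 u) (0, 0, 0) ∧
      barlowSiteForm s u k.2 = locForm (barlowWordAt s k.1.1) (barlowRelIdx k.1 u) (barlowRelIdx k.1 k.2) := by
  have hu := layer_sub_of_mem_barlowBox hub
  have hk := layer_sub_of_mem_barlowBox hkb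
  have h0 : -2 ≤ k.1.1 - k.1.1 ∧ k.1.1 - k.1.1 ≤ 2 := by omega
  have hu2 : -2 ≤ u.1 - k.1.1 ∧ u.1 - k.1.1 ≤ 2 := by omega
  have hk2 : -2 ≤ k.2.1 - k.1.1 ∧ k.2.1 - k.1.1 ≤ 2 := by omega
  refine ⟨?_, ?_, ?_⟩
  · rw [barlowSiteForm_eq_locForm s k.1 k.1 k.2 h0 hk2, barlowRelIdx_self]
  · rw [barlowSiteForm_eq_locForm s k.1 u k.1 hu2 h0, barlowRelIdx_self]
  · exact barlowSiteForm_eq_locForm s k.1 u k.2 hu2 hk2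

/-- ★★ EXCLUSION LEMMA (bonds): a site outside the candidate box of a bond has star form `≥ 108`, i.e. lies at distance
`≥ 3ν/2` from the bond midpoint (`star = 48·dist²/ν²`; census: `|2p − 2q − v|² ≥ 18`). [this file] -/
theorem le_barlowStarForm_of_bond (hs : IsHaggSeq s) {u : Idx} {k : Idx × Idx} (hk : barlowSiteForm s k.1 k.2 = 12)
    (hu : u ∉ barlowCand s k) : 108 ≤ barlowStarForm s u k := by
  have hF1 : ¬ barlowSiteForm s u k.1 ≤ 12 := fun h => hu (mem_barlowCand_of_form_le hs (Or.inl h))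
  have hF2 : ¬ barlowSiteForm s u k.2 ≤ 12 := fun h => hu (mem_barlowCand_of_form_le hs (Or.inr h))
  unfold barlowStarForm
  rw [hk]
  suffices hsum : 60 ≤ barlowSiteForm s u k.1 + barlowSiteForm s u k.2 by linarith
  by_cases h60 : 60 ≤ barlowSiteForm s u k.1
  · linarith [barlowSiteForm_nonneg s u k.2]
  -- the complete boxes (all box arguments explicit, applications elaborated before their expected types: see `forms_eq_locForm`)
  have hub : u ∈ barlowBox k.1 2 5 3 := (mem_barlowBox_of_form_le (u := u) (u₀ := k.1) (K := 59) (Ll := 2) (La := 5) (Lb := 3)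
    hs (by omega) (by norm_num) (by norm_num) (by norm_num) :)
  have hkb : k.2 ∈ barlowBox k.1 1 2 1 := (mem_barlowBox_of_form_le (u := k.2) (u₀ := k.1) (K := 12) (Ll := 1) (La := 2)
    (Lb := 1) hs (by rw [barlowSiteForm_comm]; omega) (by norm_num) (by norm_num) (by norm_num) :)
  obtain ⟨e0, e1, e2⟩ := (forms_eq_locForm s u k 2 5 3 1 2 1 (by norm_num) (by norm_num) hub hkb :)
  have hub' : barlowRelIdx k.1 u ∈ barlowLocBox 2 5 3 :=
    (barlowRelIdx_mem_barlowLocBox (k₁ := k.1) (u := u) (Ll := 2) (La := 5) (Lb := 3) hub :)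
  have hkb' : barlowRelIdx k.1 k.2 ∈ barlowLocBox 1 2 1 :=
    (barlowRelIdx_mem_barlowLocBox (k₁ := k.1) (u := k.2) (Ll := 1) (La := 2) (Lb := 1) hkb :)
  rw [e1] at hF1 ⊢
  rw [e2] at hF2 ⊢
  rw [e0] at hk
  have hw := barlowWordAt_mem hs k.1.1
  rcases hs (k.1.1 - 2) with hσ | hσ
  · rw [hσ] at hw
    rcases (locKernel_bond_pos (barlowWordAt s k.1.1) hw (barlowRelIdx k.1 k.2) hkb' hk (barlowRelIdx k.1 u) hub' :) with h | h | h
    · exact absurd h hF1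
    · exact absurd h hF2
    · exact h
  · rw [hσ] at hw
    rcases (locKernel_bond_neg (barlowWordAt s k.1.1) hw (barlowRelIdx k.1 k.2) hkb' hk (barlowRelIdx k.1 u) hub' :) with h | h | h
    · exact absurd h hF1
    · exact absurd h hF2
    · exact h

/-- ★★ EXCLUSION LEMMA (contact pairs): a site outside the candidate box of a contact pair (`F = 24`) has star form `≥ 48`,
i.e. lies at distance `≥ ν` from the contact point. [this file] -/
theorem le_barlowStarForm_of_contact (hs : IsHaggSeq s) {u : Idx} {k : Idx × Idx} (hk : barlowSiteForm s k.1 k.2 = 24)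
    (hu : u ∉ barlowCand s k) : 48 ≤ barlowStarForm s u k := by
  have hF1 : ¬ barlowSiteForm s u k.1 ≤ 12 := fun h => hu (mem_barlowCand_of_form_le hs (Or.inl h))
  have hF2 : ¬ barlowSiteForm s u k.2 ≤ 12 := fun h => hu (mem_barlowCand_of_form_le hs (Or.inr h))
  unfold barlowStarForm
  rw [hk]
  suffices hsum : 36 ≤ barlowSiteForm s u k.1 + barlowSiteForm s u k.2 by linarith
  by_cases h36 : 36 ≤ barlowSiteForm s u k.1
  · linarith [barlowSiteForm_nonneg s u k.2]
  have hub : u ∈ barlowBox k.1 2 4 2 := (mem_barlowBox_of_form_le (u := u) (u₀ := k.1) (K := 35) (Ll := 2) (La := 4) (Lb := 2)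
    hs (by omega) (by norm_num) (by norm_num) (by norm_num) :)
  have hkb : k.2 ∈ barlowBox k.1 1 3 2 := (mem_barlowBox_of_form_le (u := k.2) (u₀ := k.1) (K := 24) (Ll := 1) (La := 3)
    (Lb := 2) hs (by rw [barlowSiteForm_comm]; omega) (by norm_num) (by norm_num) (by norm_num) :)
  obtain ⟨e0, e1, e2⟩ := (forms_eq_locForm s u k 2 4 2 1 3 2 (by norm_num) (by norm_num) hub hkb :)
  have hub' : barlowRelIdx k.1 u ∈ barlowLocBox 2 4 2 :=
    (barlowRelIdx_mem_barlowLocBox (k₁ := k.1) (u := u) (Ll := 2) (La := 4) (Lb := 2) hub :)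
  have hkb' : barlowRelIdx k.1 k.2 ∈ barlowLocBox 1 3 2 :=
    (barlowRelIdx_mem_barlowLocBox (k₁ := k.1) (u := k.2) (Ll := 1) (La := 3) (Lb := 2) hkb :)
  rw [e1] at hF1 ⊢
  rw [e2] at hF2 ⊢
  rw [e0] at hk
  have hw := barlowWordAt_mem hs k.1.1
  have hσ : s (k.1.1 - 2) ∈ ({1, -1} : Finset ℤ) := by
    rcases hs (k.1.1 - 2) with h | h <;> simp [h]
  rcases (locKernel_contact (s (k.1.1 - 2)) hσ (barlowWordAt s k.1.1) hw (barlowRelIdx k.1 k.2) hkb' hk (barlowRelIdx k.1 u) hub' :)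
    with h | h | h
  · exact absurd h hF1
  · exact absurd h hF2
  · exact h

/-! ## §4 Soundness of the k-major star condition -/

/-- ★★ (A3) FROM THE k-MAJOR CONDITION: with (A0) every listed pair a bond or a contact pair, (A2) `cN + 2·wN u < D` on the
band set `B` (real form: `r₀ + 2·w u < ν`), nonnegative widths and `cN`, the candidate-box condition (A3k) implies the
site-major star domination (A3) of «CollarAtlas» `hWd_of_atlas` — outside the candidate box the integer star test fails. [this file] -/
theorem hA3_of_cand (hs : IsHaggSeq s) (I : Finset (Idx × Idx)) (B : Finset Idx) {D : ℕ} {cN : ℤ} (hcN : 0 ≤ cN)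
    (wN : Idx → ℤ) (WN : Idx × Idx → ℤ) (hw0 : ∀ u, 0 ≤ wN u)
    (A0 : ∀ k ∈ I, barlowSiteForm s k.1 k.2 = 12 ∨ barlowSiteForm s k.1 k.2 = 24)
    (A2 : ∀ u ∈ B, cN + 2 * wN u < D)
    (A3k : ∀ k ∈ I, ∀ u ∈ barlowCand s k, u ∈ B →
      (D : ℤ) ^ 2 * barlowStarForm s u k ≤ 12 * (2 * cN + 4 * wN u + pieceRadiusN s D k) ^ 2 → wN u ≤ WN k) :
    ∀ u ∈ B, ∀ k ∈ I,
      (D : ℤ) ^ 2 * barlowStarForm s u k ≤ 12 * (2 * cN + 4 * wN u + pieceRadiusN s D k) ^ 2 → wN u ≤ WN k := by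
  intro u hu k hk htest
  by_cases hc : u ∈ barlowCand s k
  · exact A3k k hk u hc hu htest
  exfalso
  have hsm := A2 u hu
  have hw := hw0 u
  have hD2 : (0 : ℤ) ≤ (D : ℤ) ^ 2 := sq_nonneg _
  rcases A0 k hk with h12 | h24
  · have hstar := mul_le_mul_of_nonneg_left (le_barlowStarForm_of_bond hs h12 hc) hD2
    have hp : pieceRadiusN s D k = D := by simp [pieceRadiusN, h12]
    rw [hp] at htest
    have hn0 : 0 ≤ 2 * cN + 4 * wN u + D := by positivity
    have hn : 2 * cN + 4 * wN u + D < 3 * D := by linarith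
    have hn2 : (2 * cN + 4 * wN u + D) ^ 2 < (3 * D) ^ 2 := pow_lt_pow_left₀ hn hn0 two_ne_zero
    nlinarith
  · have hstar := mul_le_mul_of_nonneg_left (le_barlowStarForm_of_contact hs h24 hc) hD2
    have hp : pieceRadiusN s D k = 0 := by simp [pieceRadiusN, h24]
    rw [hp, add_zero] at htest
    have hn0 : 0 ≤ 2 * cN + 4 * wN u := by positivity
    have hn : 2 * cN + 4 * wN u < 2 * D := by linarith
    have hn2 : (2 * cN + 4 * wN u) ^ 2 < (2 * D) ^ 2 := pow_lt_pow_left₀ hn hn0 two_ne_zero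
    nlinarith

/-- ★ hWd AND hW0 OF THE INTERFACE ROW FROM THE k-MAJOR CONDITIONS: «CollarAtlas» `hWd_of_atlas` with (A3) supplied by
`hA3_of_cand` from (A0), (A2), (A3k). [this file + «CollarAtlas»] -/
theorem hWd_of_cand (hs : IsHaggSeq s) (hν : 0 < ν) {r₀ : ℝ} (hr₀ : r₀ = ν / Real.sqrt 2) (I : Finset (Idx × Idx))
    (B : Finset Idx) {D : ℕ} (hD : 0 < D) {cN : ℤ} (hcN : 0 ≤ cN) (hc : (D : ℤ) ^ 2 ≤ 2 * cN ^ 2) (wN : Idx → ℤ)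
    (WN : Idx × Idx → ℤ) (hw0 : ∀ u, 0 ≤ wN u) (hwB : ∀ u ∉ B, wN u = 0)
    (A0 : ∀ k ∈ I, barlowSiteForm s k.1 k.2 = 12 ∨ barlowSiteForm s k.1 k.2 = 24)
    (A2 : ∀ u ∈ B, cN + 2 * wN u < D)
    (A3k : ∀ k ∈ I, ∀ u ∈ barlowCand s k, u ∈ B →
      (D : ℤ) ^ 2 * barlowStarForm s u k ≤ 12 * (2 * cN + 4 * wN u + pieceRadiusN s D k) ^ 2 → wN u ≤ WN k)
    (A4 : ∀ k ∈ I, 0 ≤ WN k) :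
    (∀ k ∈ I, (0 : ℝ) ≤ ν * (WN k : ℝ) / D) ∧
      ∀ u, ∀ k ∈ I, dist (placedSite s ν q R u) (midpoint ℝ (placedSite s ν q R k.1) (placedSite s ν q R k.2)) ≤
        r₀ + 2 * (ν * (wN u : ℝ) / D) + pieceRadius s ν k → ν * (wN u : ℝ) / D ≤ ν * (WN k : ℝ) / D :=
  hWd_of_atlas hν hr₀ I B hD hcN hc wN WN hw0 hwB (hA3_of_cand hs I B hcN wN WN hw0 A0 A2 A3k) A4

end

end Summit.AtomisticToContinuum.Crystallization.Theorems.OverbindingBudgetAffineFarFieldCollarStar
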